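import Mathlib
import HarnessLib
import Summits.Langlands.Langlands.Theorems.ExteriorSquareAscentInducedSquareAscentRegroup
import Summits.Langlands.Langlands.Theorems.ExteriorSquareAscentInducedSquareAscentIdentitiesAB
import Literature.NumberTheory.Automorphic.PairLFunctionBaseChange
import Literature.NumberTheory.Automorphic.KimExteriorSquareGL4

/-!
# The Euler-product identity (✦) of the Klein-cube line (crux `InducedSquareAscent`)

Companion of `…InducedSquareAscentIdentitiesAB`. With the same conventions (quadratic Galois `L/K`,
`τ ≠ 1`, `S ⊇` ramified places, Satake families `α` over `K` and `B` over `L` related by the induced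
exterior-square matching off `S`, value functions `ωL w = (∏ α v)^{f(w|v)}`, `Ω w = ∏ B w`), and in
addition a value function `c` on the places of `K` with `cL w = c(v)^{f(w|v)}` (a Hecke character of
`K` and its base change), the **Klein cube identity**

  `L^S(α ⊗ (ωc)α) · L^S(α⁻¹ ⊗ (ω²c)α⁻¹) = L^T({Ω·cL} ⊗ 1) · L^T(B⁻¹ ⊗ (Ω cL) B^τ) · L^T((ωL cL) B ⊗ 1)²`

(`kleinHelper_identityStar`) holds at every `s` at which the five Euler products are multipliable —
the automorphic shadow of the `A₃ = D₃` plethysm `∧³(∧²V) = Sym²V ⊗ det ⊕ Sym²V^∨ ⊗ det²` read on the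
induced side. It is obtained by regrouping the `L`-side products along `w ↦ w ∩ 𝓞_K` (`regroup_tprod`)
and the local identities (5) (split) and (6) (inert) of `stub_localIdentities`, taken as hypotheses
(`hLI5`, `hLI6`) verbatim. No named fact is used.
-/

set_option linter.unusedVariables false
set_option linter.dupNamespace false

noncomputable section

namespace Summit.Langlands.Langlands.Theorems.InducedSquareAscentKleinCube

open scoped Classical NumberField Topology
open Filter IsDedekindDomain NumberField
open Literature.NumberTheory.Automorphic

variable {K L : Type} [Field K] [NumberField K] [Field L] [NumberField L] [Algebra K L]

/-- **Identity (✦) of the Klein-cube line** (module docstring): `K`-side = `L`-side regrouped over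
`v ∉ S`, fibre by fibre by the local identities (5), (6). [cite: ArthurClozelAMS120, Ch. 3, Lemma 4.3] -/
theorem kleinHelper_identityStar :
    ∀ (K L : Type) [Field K] [NumberField K] [Field L] [NumberField L] [Algebra K L] [IsGalois K L], Module.finrank K L = 2 → ∀ (τ : L ≃ₐ[K] L), τ ≠ 1 → (∀ (x c : ℂ) (α β₁ β₂ : Multiset ℂ), Multiset.card α = 4 → (∀ a ∈ α, a ≠ 0) → Multiset.card β₁ = 3 → Multiset.card β₂ = 3 → wedgeTwoParams α = β₁ + β₂ → ((satakePairPolynomial α (α.map ((α.prod * c) * ·))).eval x) * ((satakePairPolynomial (α.map (·⁻¹)) ((α.map (·⁻¹)).map ((α.prod ^ 2 * c) * ·))).eval x) = (((satakePairPolynomial {β₁.prod * c} {1}).eval x) * ((satakePairPolynomial {β₂.prod * c} {1}).eval x)) * (((satakePairPolynomial (β₁.map (·⁻¹)) (β₂.map ((β₁.prod * c) * ·))).eval x) * ((satakePairPolynomial (β₂.map (·⁻¹)) (β₁.map ((β₂.prod * c) * ·))).eval x)) * (((satakePairPolynomial (β₁.map ((α.prod * c) * ·)) {1}).eval x) * ((satakePairPolynomial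 (β₂.map ((α.prod * c) * ·)) {1}).eval x)) ^ 2) → (∀ (x c : ℂ) (α γ : Multiset ℂ), Multiset.card α = 4 → (∀ a ∈ α, a ≠ 0) → Multiset.card γ = 3 → wedgeTwoParams α = γ + γ.map (-·) → ((satakePairPolynomial α (α.map ((α.prod * c) * ·))).eval x) * ((satakePairPolynomial (α.map (·⁻¹)) ((α.map (·⁻¹)).map ((α.prod ^ 2 * c) * ·))).eval x) = ((satakePairPolynomial {(γ.map (· ^ 2)).prod * c ^ 2} {1}).eval (x ^ 2)) * ((satakePairPolynomial ((γ.map (· ^ 2)).map (·⁻¹)) ((γ.map (· ^ 2)).map (((γ.map (· ^ 2)).prod * c ^ 2) * ·))).eval (x ^ 2)) * ((satakePairPolynomial ((γ.map (· ^ 2)).map ((α.prod ^ 2 * c ^ 2) * ·)) {1}).eval (x ^ 2)) ^ 2) → ∀ (S : Set (HeightOneSpectrum (𝓞 K))) (α : SatakeFamily K) (B : SatakeFamily L) (c : HeightOneSpectrum (𝓞 K) → ℂ) (ωL Ω cL : HeightOneSpectrum (𝓞 L) → ℂ), (∀ v ∉ S, v.asIdeal.ramificationIdxIn (𝓞 L)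 = 1) → (∀ v ∉ S, Multiset.card (α v) = 4 ∧ ∀ a ∈ α v, a ≠ 0) → (∀ w : HeightOneSpectrum (𝓞 L), w.under (𝓞 K) ∉ S → Multiset.card (B w) = 3) → (∀ w : HeightOneSpectrum (𝓞 L), w.under (𝓞 K) ∉ S → ωL w = (α (w.under (𝓞 K))).prod ^ w.asIdeal.inertiaDeg (𝓞 K)) → (∀ w : HeightOneSpectrum (𝓞 L), w.under (𝓞 K) ∉ S → Ω w = (B w).prod) → (∀ w : HeightOneSpectrum (𝓞 L), w.under (𝓞 K) ∉ S → cL w = (c (w.under (𝓞 K))) ^ w.asIdeal.inertiaDeg (𝓞 K)) → (∀ v ∉ S, ∀ w : HeightOneSpectrum (𝓞 L), w.under (𝓞 K) = v → w.asIdeal.inertiaDeg (𝓞 K) = 1 → wedgeTwoParams (α v) = B w + B (τ • w)) → (∀ v ∉ S, ∀ w : HeightOneSpectrum (𝓞 L), w.under (𝓞 K) = v → w.asIdeal.inertiaDeg (𝓞 K) = 2 → ∃ γ : Multiset ℂ, Multiset.card γ = 3 ∧ γ.map (· ^ 2) = B w ∧ wedgeTwoParams (α v) = γ + γ.map (-·))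 → ∀ (s : ℂ), Multipliable (fun v : {v : HeightOneSpectrum (𝓞 K) // v ∉ S} => ((satakePairPolynomial (α v.1) ((α v.1).map (((α v.1).prod * c v.1) * ·))).eval ((v.1.residueCard : ℂ) ^ (-s)))⁻¹) → Multipliable (fun v : {v : HeightOneSpectrum (𝓞 K) // v ∉ S} => ((satakePairPolynomial ((α v.1).map (·⁻¹)) (((α v.1).map (·⁻¹)).map (((α v.1).prod ^ 2 * c v.1) * ·))).eval ((v.1.residueCard : ℂ) ^ (-s)))⁻¹) → Multipliable (fun w : {w : HeightOneSpectrum (𝓞 L) // w.under (𝓞 K) ∉ S} => ((satakePairPolynomial {Ω w.1 * cL w.1} {1}).eval ((w.1.residueCard : ℂ) ^ (-s)))⁻¹) → Multipliable (fun w : {w : HeightOneSpectrum (𝓞 L) // w.under (𝓞 K) ∉ S} => ((satakePairPolynomial ((B w.1).map (·⁻¹)) ((B (τ • w.1)).map ((Ω w.1 * cL w.1) * ·))).eval ((w.1.residueCard : ℂ) ^ (-s)))⁻¹) → Multipliable (fun w : {w : HeightOneSpectrum (𝓞 L) // w.under (𝓞 K) ∉ S} => ((satakePairPolynomial ((B w.1).map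 ((ωL w.1 * cL w.1) * ·)) {1}).eval ((w.1.residueCard : ℂ) ^ (-s)))⁻¹) → partialPairL S α (fun v => (α v).map (((α v).prod * c v) * ·)) s * partialPairL S (fun v => (α v).map (·⁻¹)) (fun v => ((α v).map (·⁻¹)).map (((α v).prod ^ 2 * c v) * ·)) s = partialPairL {w : HeightOneSpectrum (𝓞 L) | w.under (𝓞 K) ∈ S} (fun w => {Ω w * cL w}) (fun _ => {1}) s * partialPairL {w : HeightOneSpectrum (𝓞 L) | w.under (𝓞 K) ∈ S} (fun w => (B w).map (·⁻¹)) (fun w => (B (τ • w)).map ((Ω w * cL w) * ·)) s * (partialPairL {w : HeightOneSpectrum (𝓞 L) | w.under (𝓞 K) ∈ S} (fun w => (B w).map ((ωL w * cL w) * ·)) (fun _ => {1}) s) ^ 2 := by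
  intro K L _ _ _ _ _ _ hdeg τ hτ hLI5 hLI6 S α B c ωL Ω cL hS hα hB hωL hΩ hcL hsplit hinert s
    hm1 hm2 hmξ hmτ hm3
  -- Euler factors
  set F₁ : HeightOneSpectrum (𝓞 K) → ℂ := fun v =>
    ((satakePairPolynomial (α v) ((α v).map (((α v).prod * c v) * ·))).eval
      ((v.residueCard : ℂ) ^ (-s)))⁻¹ with hF₁
  set F₂ : HeightOneSpectrum (𝓞 K) → ℂ := fun v =>
    ((satakePairPolynomial ((α v).map (·⁻¹)) (((α v).map (·⁻¹)).map (((α v).prod ^ 2 * c v) * ·))).eval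
      ((v.residueCard : ℂ) ^ (-s)))⁻¹ with hF₂
  set Gξ : HeightOneSpectrum (𝓞 L) → ℂ := fun w =>
    ((satakePairPolynomial ({Ω w * cL w} : Multiset ℂ) ({1} : Multiset ℂ)).eval
      ((w.residueCard : ℂ) ^ (-s)))⁻¹ with hGξ
  set Gτ : HeightOneSpectrum (𝓞 L) → ℂ := fun w =>
    ((satakePairPolynomial ((B w).map (·⁻¹)) ((B (τ • w)).map ((Ω w * cL w) * ·))).eval
      ((w.residueCard : ℂ) ^ (-s)))⁻¹ with hGτ
  set G₃ : HeightOneSpectrum (𝓞 L) → ℂ := fun w =>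
    ((satakePairPolynomial ((B w).map ((ωL w * cL w) * ·)) ({1} : Multiset ℂ)).eval
      ((w.residueCard : ℂ) ^ (-s)))⁻¹ with hG₃
  set h : HeightOneSpectrum (𝓞 K) → ℂ := fun v => F₁ v * F₂ v with hh
  -- fibre identities
  have hs_fib : ∀ v ∉ S, ∀ w : HeightOneSpectrum (𝓞 L), w.under (𝓞 K) = v →
      w.asIdeal.inertiaDeg (𝓞 K) = 1 →
      (fun w => Gξ w * Gτ w * G₃ w ^ 2) w * (fun w => Gξ w * Gτ w * G₃ w ^ 2) (τ • w) = h v := by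
    intro v hv w hw hf
    have hvS : w.under (𝓞 K) ∉ S := by rw [hw]; exact hv
    have hτw : (τ • w).under (𝓞 K) = v := by rw [HeightOneSpectrum.under_algEquiv_smul, hw]
    have hτvS : (τ • w).under (𝓞 K) ∉ S := by rw [hτw]; exact hv
    have hfτ : (τ • w).asIdeal.inertiaDeg (𝓞 K) = 1 := by rw [inertiaDeg_smul_eq, hf]
    have hwedge := hsplit v hv w hw hf
    have hωw : ωL w = (α v).prod := by rw [hωL w hvS, hw, hf, pow_one]
    have hωτ : ωL (τ • w) = (α v).prod := by rw [hωL _ hτvS, hτw, hfτ, pow_one]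
    have hΩw : Ω w = (B w).prod := hΩ w hvS
    have hΩτ : Ω (τ • w) = (B (τ • w)).prod := hΩ _ hτvS
    have hcw : cL w = c v := by rw [hcL w hvS, hw, hf, pow_one]
    have hcτ : cL (τ • w) = c v := by rw [hcL _ hτvS, hτw, hfτ, pow_one]
    have hq : ((τ • w).residueCard : ℂ) = (w.residueCard : ℂ) := by
      obtain ⟨-, hq1, -⟩ := fibre_of_inertiaDeg_eq_one hdeg hτ (hS v hv) hw hf
      obtain ⟨-, hq2, -⟩ := fibre_of_inertiaDeg_eq_one hdeg hτ (hS v hv) hτw hfτ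
      rw [hq1, hq2]
    have hqv : (w.residueCard : ℂ) = (v.residueCard : ℂ) := by
      obtain ⟨-, hq1, -⟩ := fibre_of_inertiaDeg_eq_one hdeg hτ (hS v hv) hw hf
      rw [hq1]
    have hττ : τ • τ • w = w := smul_smul_eq_self hdeg τ w
    have key := hLI5 ((v.residueCard : ℂ) ^ (-s)) (c v) (α v) (B w) (B (τ • w)) (hα v hv).1 (hα v hv).2
      (hB w hvS) (hB _ hτvS) hwedge
    simp only [hh, hF₁, hF₂, hGξ, hGτ, hG₃, hττ, hωw, hωτ, hΩw, hΩτ, hcw, hcτ, hq, hqv]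
    set x := (v.residueCard : ℂ) ^ (-s) with hxdef
    set P₁ := (satakePairPolynomial (α v) ((α v).map (((α v).prod * c v) * ·))).eval x
    set P₂ := (satakePairPolynomial ((α v).map (·⁻¹)) (((α v).map (·⁻¹)).map (((α v).prod ^ 2 * c v) * ·))).eval x
    set Q1 := (satakePairPolynomial ({(B w).prod * c v} : Multiset ℂ) ({1} : Multiset ℂ)).eval x
    set Q2 := (satakePairPolynomial ({(B (τ • w)).prod * c v} : Multiset ℂ) ({1} : Multiset ℂ)).eval x
    set R1 := (satakePairPolynomial ((B w).map (·⁻¹)) ((B (τ • w)).map (((B w).prod * c v) * ·))).eval x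
    set R2 := (satakePairPolynomial ((B (τ • w)).map (·⁻¹)) ((B w).map (((B (τ • w)).prod * c v) * ·))).eval x
    set U1 := (satakePairPolynomial ((B w).map (((α v).prod * c v) * ·)) ({1} : Multiset ℂ)).eval x
    set U2 := (satakePairPolynomial ((B (τ • w)).map (((α v).prod * c v) * ·)) ({1} : Multiset ℂ)).eval x
    -- `key : P₁ * P₂ = (Q1 * Q2) * (R1 * R2) * (U1 * U2) ^ 2`
    calc Q1⁻¹ * R1⁻¹ * (U1⁻¹) ^ 2 * (Q2⁻¹ * R2⁻¹ * (U2⁻¹) ^ 2)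
        = ((Q1 * Q2) * (R1 * R2) * (U1 * U2) ^ 2)⁻¹ := by ring
      _ = (P₁ * P₂)⁻¹ := by rw [key]
      _ = P₁⁻¹ * P₂⁻¹ := mul_inv P₁ P₂
  have hi_fib : ∀ v ∉ S, ∀ w : HeightOneSpectrum (𝓞 L), w.under (𝓞 K) = v →
      w.asIdeal.inertiaDeg (𝓞 K) = 2 → (fun w => Gξ w * Gτ w * G₃ w ^ 2) w = h v := by
    intro v hv w hw hf
    have hvS : w.under (𝓞 K) ∉ S := by rw [hw]; exact hv
    obtain ⟨γ, hγ3, hγB, hγα⟩ := hinert v hv w hw hf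
    have hne : ¬ ∃ w : HeightOneSpectrum (𝓞 L), w.under (𝓞 K) = v ∧
        w.asIdeal.inertiaDeg (𝓞 K) = 1 := by
      rintro ⟨w₀, hw₀, hf₀⟩
      have := inertiaDeg_eq_of_under_eq (K := K) (hw.trans hw₀.symm)
      omega
    obtain ⟨w₀, hw₀, -, hτw₀, -, hall⟩ := fibre_of_not_exists_inertiaDeg_eq_one hdeg hτ (hS v hv) hne
    have hww : w = w₀ := hall w hw
    have hτw : τ • w = w := by rw [hww, hτw₀]
    have hωw : ωL w = (α v).prod ^ 2 := by rw [hωL w hvS, hw, hf]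
    have hΩw : Ω w = (B w).prod := hΩ w hvS
    have hcw : cL w = c v ^ 2 := by rw [hcL w hvS, hw, hf]
    have hq : (w.residueCard : ℂ) ^ (-s) = ((v.residueCard : ℂ) ^ (-s)) ^ 2 := by
      rw [residueCard_cpow_neg_eq_pow (K := K) w s, hw, hf]
    have key := hLI6 ((v.residueCard : ℂ) ^ (-s)) (c v) (α v) γ (hα v hv).1 (hα v hv).2 hγ3 hγα
    rw [hγB] at key
    simp only [hh, hF₁, hF₂, hGξ, hGτ, hG₃, hτw, hωw, hΩw, hcw, hq]
    set x := (v.residueCard : ℂ) ^ (-s) with hxdef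
    set P₁ := (satakePairPolynomial (α v) ((α v).map (((α v).prod * c v) * ·))).eval x
    set P₂ := (satakePairPolynomial ((α v).map (·⁻¹)) (((α v).map (·⁻¹)).map (((α v).prod ^ 2 * c v) * ·))).eval x
    set Q := (satakePairPolynomial ({(B w).prod * c v ^ 2} : Multiset ℂ) ({1} : Multiset ℂ)).eval (x ^ 2)
    set R := (satakePairPolynomial ((B w).map (·⁻¹)) ((B w).map (((B w).prod * c v ^ 2) * ·))).eval (x ^ 2)
    set U := (satakePairPolynomial ((B w).map (((α v).prod ^ 2 * c v ^ 2) * ·)) ({1} : Multiset ℂ)).eval (x ^ 2)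
    -- `key : P₁ * P₂ = Q * R * U ^ 2`
    calc Q⁻¹ * R⁻¹ * (U⁻¹) ^ 2 = (Q * R * U ^ 2)⁻¹ := by ring
      _ = (P₁ * P₂)⁻¹ := by rw [key]
      _ = P₁⁻¹ * P₂⁻¹ := mul_inv P₁ P₂
  obtain ⟨hmh, hreg⟩ := regroup_tprod hdeg hτ S (fun w => Gξ w * Gτ w * G₃ w ^ 2) h hS hs_fib hi_fib
    ((hmξ.mul hmτ).mul (hm3.pow 2))
  -- assemble
  have hLHS : partialPairL S α (fun v => (α v).map (((α v).prod * c v) * ·)) s *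
      partialPairL S (fun v => (α v).map (·⁻¹)) (fun v => ((α v).map (·⁻¹)).map (((α v).prod ^ 2 * c v) * ·)) s =
      ∏' v : {v : HeightOneSpectrum (𝓞 K) // v ∉ S}, (F₁ v.1 * F₂ v.1) := by
    rw [Multipliable.tprod_mul hm1 hm2]; rfl
  have hRHS : partialPairL {w : HeightOneSpectrum (𝓞 L) | w.under (𝓞 K) ∈ S}
        (fun w => ({Ω w * cL w} : Multiset ℂ)) (fun _ => ({1} : Multiset ℂ)) s *
      partialPairL {w : HeightOneSpectrum (𝓞 L) | w.under (𝓞 K) ∈ S} (fun w => (B w).map (·⁻¹))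
        (fun w => (B (τ • w)).map ((Ω w * cL w) * ·)) s *
      (partialPairL {w : HeightOneSpectrum (𝓞 L) | w.under (𝓞 K) ∈ S}
        (fun w => (B w).map ((ωL w * cL w) * ·)) (fun _ => ({1} : Multiset ℂ)) s) ^ 2 =
      ∏' w : {w : HeightOneSpectrum (𝓞 L) // w.under (𝓞 K) ∉ S}, (Gξ w.1 * Gτ w.1 * G₃ w.1 ^ 2) := by
    rw [Multipliable.tprod_mul (hmξ.mul hmτ) (hm3.pow 2), Multipliable.tprod_mul hmξ hmτ,
      Multipliable.tprod_pow hm3]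
    rfl
  rw [hLHS, hRHS, hreg]

end Summit.Langlands.Langlands.Theorems.InducedSquareAscentKleinCube

end
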